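import Summits.Schanuel.Schanuel.Theorems.ZilberEacPunctureDensityPoly
import HarnessLib

/-!
# Non-real hyperplane bases in dimension `≥ 3`: certified members of `EC(s+2, s+1)` with Zariski
# dense exponential points

Zilber's Exponential-Algebraic Closedness, case ladder (host summit Schanuel, cell `pub-schanuel`,
seat 2, gen 9).  In dimension `2` the lines of NON-REAL slope were the easy (escape) case of
Mantova–Masser's density question (`EACDensityLineTwist`, `ZilberEacMovingLine`).  Their
`(s+2)`-dimensional analogues are the hyperplanes `x_{s+1} = ℓ(x) = Σ rᵢ xᵢ + c` with SOME `Im rᵢ ≠ 0`: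
along the ray `2πi m q`, `Re ℓ = -2π m Σ Im(rᵢ) qᵢ + O(log m)`, so every ray with `Σ Im(rᵢ) qᵢ > 0` is a
NEGATIVE ray of the degree-one base — the puncture regime of `ZilberEacPunctureDensityPoly`.

* `isAddFree_of_vanishingIdeal_projAdd_eq_ker_linearC` — additive freeness over a COMPLEX hyperplane
  with some coefficient `rᵢ ∉ ℚ` (the complex version of `ZilberEacRealHyperplaneCell`);
* `ecCell_hypotheses_polyFibredGraph_hyperplaneC` — for `A` dominant and some `rᵢ ∉ ℚ` the
  `(s+2)`-fold `polyFibredGraph (Σ rᵢXᵢ + c) A F` satisfies all seven hypotheses of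
  `ECCell (s+2) (s+1)` (complex `r`);
* `unprojectedDense_polyFibredGraph_hyperplaneC` — some `Im rᵢ ≠ 0` (witnessed by a lattice
  direction `q₀`, all `q₀ⱼ ≠ 0`, with `Σ Im(rᵢ) q₀ᵢ > 0`), all `Aⱼ ≠ 0`, ANY `F ∈ ℂ[u, x]` ⟹
  `I(W ∩ Γ_exp) = I(W)`;
* `nonRealPlane_model_member_dense` — `{x₂ = i x₀ + x₁, y₀ = x₀ + y₂ x₁, y₁ = x₁ + y₂²}` ⊆ ℂ³ × ℂ³:
  certified member of `EC(3,2)`, not linearly split, Zariski dense exponential points.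

HONEST FRAMING: explicit families inside an OPEN cell; `EC(3,2)` OPEN; NOT Schanuel's conjecture;
EAC ⇏ SC.
-/

noncomputable section

open Complex MvPolynomial Filter Topology
open Literature.NumberTheory.Transcendental Literature.ModelTheory.Zilber
  Literature.ModelTheory.ExponentialFields

set_option linter.dupNamespace false

namespace Summit.Schanuel.Schanuel.Theorems

section ComplexHyperplane

variable {s : ℕ}

/-- **Additive freeness over a complex hyperplane with a non-rational coefficient.**  If the
additive projection of `V ⊆ ℂ^{s+2} × ℂ^{s+2}` has vanishing ideal `ker (X_{s+1} ↦ Σ rᵢ Xᵢ + c)`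
(`rᵢ ∈ ℂ`) and some `rᵢ ∉ ℚ`, then `V` is additively free. [folklore] -/
theorem isAddFree_of_vanishingIdeal_projAdd_eq_ker_linearC {V : Set (Fin (s + 2) ⊕ Fin (s + 2) → ℂ)}
    (r : Fin (s + 1) → ℂ) (c : ℂ)
    (hV : vanishingIdeal ℂ (projAdd '' V) =
      RingHom.ker (aeval (graphSubst (∑ i, C (r i) * X i + C c : MvPolynomial (Fin (s + 1)) ℂ)) :
        MvPolynomial (Fin (s + 2)) ℂ →ₐ[ℂ] MvPolynomial (Fin (s + 1)) ℂ))
    (hirr : ∃ i, ∀ ρ : ℚ, r i ≠ (ρ : ℂ)) : IsAddFree ℂ (s + 2) V := by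
  classical
  rintro m hm ⟨c', hc'⟩
  let L : MvPolynomial (Fin (s + 2)) ℂ := (∑ i, C ((m i : ℤ) : ℂ) * X i) - C c'
  have hL : L ∈ vanishingIdeal ℂ (projAdd '' V) := by
    rw [mem_vanishingIdeal_iff]
    rintro _ ⟨z, hz, rfl⟩
    have := hc' z hz
    simp only [L, map_sub, map_sum, map_mul, aeval_C, aeval_X, projAdd_apply, sub_eq_zero]
    simpa using this
  rw [hV, RingHom.mem_ker] at hL
  have hτ : aeval (graphSubst (∑ i, C (r i) * X i + C c : MvPolynomial (Fin (s + 1)) ℂ)) L =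
      (∑ j : Fin (s + 1), C ((m (Fin.castSucc j) : ℤ) : ℂ) * X j) +
        C ((m (Fin.last (s + 1)) : ℤ) : ℂ) * (∑ i, C (r i) * X i + C c) - C c' := by
    simp only [L, map_sub, map_add, map_sum, map_mul, aeval_C, aeval_X, algebraMap_eq,
      Fin.sum_univ_castSucc, graphSubst, Fin.snoc_castSucc, Fin.snoc_last]
  rw [hτ] at hL
  have hcoef : ∀ i : Fin (s + 1),
      ((m (Fin.castSucc i) : ℤ) : ℂ) + ((m (Fin.last (s + 1)) : ℤ) : ℂ) * r i = 0 := by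
    intro i
    have h := congrArg (coeff (Finsupp.single i 1)) hL
    rw [coeff_zero, coeff_sub, coeff_add, coeff_C_mul, coeff_single_one_linearForm,
      coeff_C, if_neg (by
        intro h0
        have := congrArg (fun f => f i) h0
        simp at this), sub_zero] at h
    have h2 : coeff (Finsupp.single i 1) (∑ j : Fin (s + 1), C ((m (Fin.castSucc j) : ℤ) : ℂ) * X j :
        MvPolynomial (Fin (s + 1)) ℂ) = ((m (Fin.castSucc i) : ℤ) : ℂ) := by
      have := coeff_single_one_linearForm (fun j : Fin (s + 1) => ((m (Fin.castSucc j) : ℤ) : ℂ)) 0 i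
      rwa [map_zero, add_zero] at this
    rw [h2] at h
    exact h
  by_cases hlast : m (Fin.last (s + 1)) = 0
  · apply hm
    funext i
    induction i using Fin.lastCases with
    | last => exact hlast
    | cast j =>
      have h := hcoef j
      rw [hlast, Int.cast_zero, zero_mul, add_zero] at h
      exact_mod_cast h
  · obtain ⟨i, hi⟩ := hirr
    have h := hcoef i
    have hml : ((m (Fin.last (s + 1)) : ℤ) : ℂ) ≠ 0 := by exact_mod_cast hlast
    apply hi (-((m (Fin.castSucc i) : ℤ) : ℚ) / (m (Fin.last (s + 1)) : ℤ))
    push_cast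
    field_simp
    linear_combination h

/-- **Cell membership over a complex hyperplane base.**  For `A` dominant and some `rᵢ ∉ ℚ` the
`(s+2)`-fold `polyFibredGraph (Σ rᵢXᵢ + c) A F` (`rᵢ ∈ ℂ`) satisfies all seven hypotheses of
`ECCell (s+2) (s+1)`. [folklore] -/
theorem ecCell_hypotheses_polyFibredGraph_hyperplaneC (r : Fin (s + 1) → ℂ) (c : ℂ)
    (A : Fin (s + 1) → MvPolynomial (Fin (s + 1)) ℂ) (F : Fin (s + 1) → MvPolynomial (Fin (s + 2)) ℂ)
    (hA : Function.Injective (aeval A : MvPolynomial (Fin (s + 1)) ℂ →ₐ[ℂ] MvPolynomial (Fin (s + 1)) ℂ))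
    (hirr : ∃ i, ∀ ρ : ℚ, r i ≠ (ρ : ℂ)) :
    IsIrreducibleClosed ℂ (polyFibredGraph (∑ i, C (r i) * X i + C c) A F) ∧
    (polyFibredGraph (∑ i, C (r i) * X i + C c) A F ∩ torusLocus ℂ (s + 2)).Nonempty ∧
    IsRotund ℂ (s + 2) (polyFibredGraph (∑ i, C (r i) * X i + C c) A F ∩ torusLocus ℂ (s + 2)) ∧
    IsAddFree ℂ (s + 2) (polyFibredGraph (∑ i, C (r i) * X i + C c) A F ∩ torusLocus ℂ (s + 2)) ∧
    IsMulFree ℂ (s + 2) (polyFibredGraph (∑ i, C (r i) * X i + C c) A F ∩ torusLocus ℂ (s + 2)) ∧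
    zariskiDim ℂ (polyFibredGraph (∑ i, C (r i) * X i + C c) A F) = (s + 2 : ℕ) ∧
    addProjDim ℂ (s + 2) (polyFibredGraph (∑ i, C (r i) * X i + C c) A F) = (s + 1 : ℕ) :=
  ⟨isIrreducibleClosed_polyFibredGraph _ _ _, polyFibredGraph_inter_torusLocus_nonempty _ _ _ hA,
    isRotund_polyFibredGraph _ _ _ hA,
    isAddFree_of_vanishingIdeal_projAdd_eq_ker_linearC r c
      (vanishingIdeal_projAdd_polyFibredGraph _ _ _ hA) hirr,
    isMulFree_polyFibredGraph _ _ _ hA, zariskiDim_polyFibredGraph _ _ _,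
    addProjDim_polyFibredGraph _ _ _ hA⟩

/-- A non-real coefficient is not rational. [folklore] -/
theorem forall_rat_ne_of_im_ne_zero {z : ℂ} (hz : z.im ≠ 0) : ∀ ρ : ℚ, z ≠ (ρ : ℂ) := by
  intro ρ h
  apply hz
  rw [h]
  exact Complex.ratCast_im ρ

/-- **Density over complex hyperplanes with a non-real coefficient.**  `rᵢ ∈ ℂ`, a lattice direction
`q₀` with all `q₀ⱼ ≠ 0` and `Σ Im(rᵢ) q₀ᵢ > 0` (exists iff some `Im rᵢ ≠ 0`), all `Aⱼ ≠ 0`, ANY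
`F ∈ ℂ[u, x]`: the exponential points of `polyFibredGraph (Σ rᵢXᵢ + c) A F` are Zariski dense —
the ray `q₀` is a negative ray of the degree-one base. (new)
[cite: MantovaMasser2023, §1 p.5 (the open case dim π(V) = 2 in ℂ³×ℂˣ³)] -/
theorem unprojectedDense_polyFibredGraph_hyperplaneC (r : Fin (s + 1) → ℂ) (c : ℂ)
    (q₀ : Fin (s + 1) → ℤ) (hq₀0 : ∀ j, q₀ j ≠ 0) (hq₀ : 0 < ∑ i, (r i).im * (q₀ i : ℝ))
    (A : Fin (s + 1) → MvPolynomial (Fin (s + 1)) ℂ) (hA0 : ∀ j, A j ≠ 0)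
    (F : Fin (s + 1) → MvPolynomial (Fin (s + 2)) ℂ) :
    UnprojectedDense (polyFibredGraph (∑ i, C (r i) * X i + C c) A F) := by
  classical
  -- some coefficient is nonzero
  obtain ⟨k, hk⟩ : ∃ k, r k ≠ 0 := by
    by_contra hcon
    push Not at hcon
    have : ∑ i, (r i).im * (q₀ i : ℝ) = 0 := Finset.sum_eq_zero fun i _ => by rw [hcon i]; simp
    linarith
  have hdeg : (∑ i, C (r i) * X i + C c : MvPolynomial (Fin (s + 1)) ℂ).totalDegree = 1 :=
    totalDegree_linearForm r c hk
  refine unprojectedDense_polyFibredGraph_puncture _ (by rw [hdeg]; exact one_pos) q₀ ?_ hq₀0 A hA0 F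
  rw [eval_leadingForm_linearForm r c hk]
  have hsum : (∑ i, r i * (2 * Real.pi * I * (q₀ i : ℂ))).re = -(2 * Real.pi) * ∑ i, (r i).im * (q₀ i : ℝ) := by
    rw [Complex.re_sum, Finset.mul_sum]
    refine Finset.sum_congr rfl fun i _ => ?_
    have : r i * (2 * Real.pi * I * (q₀ i : ℂ)) = (2 * Real.pi * (q₀ i : ℝ) : ℝ) * (r i * I) := by
      push_cast; ring
    rw [this, Complex.re_ofReal_mul, Complex.mul_I_re]
    ring
  rw [hsum]
  have := Real.pi_pos
  nlinarith

/-- **Certified members over complex hyperplanes, dense.**  `A` dominant, a ray `q₀` as above,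
ANY `F`: all seven `ECCell (s+2) (s+1)` hypotheses, not linearly split, and `I(W ∩ Γ_exp) = I(W)`.
(new) [cite: MantovaMasser2023, §1 p.5 (the open case dim π(V) = 2 in ℂ³×ℂˣ³)] -/
theorem polyFibredGraph_hyperplaneC_member_dense (r : Fin (s + 1) → ℂ) (c : ℂ)
    (q₀ : Fin (s + 1) → ℤ) (hq₀0 : ∀ j, q₀ j ≠ 0) (hq₀ : 0 < ∑ i, (r i).im * (q₀ i : ℝ))
    (A : Fin (s + 1) → MvPolynomial (Fin (s + 1)) ℂ)
    (hA : Function.Injective (aeval A : MvPolynomial (Fin (s + 1)) ℂ →ₐ[ℂ] MvPolynomial (Fin (s + 1)) ℂ))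
    (F : Fin (s + 1) → MvPolynomial (Fin (s + 2)) ℂ) :
    (IsIrreducibleClosed ℂ (polyFibredGraph (∑ i, C (r i) * X i + C c) A F) ∧
      (polyFibredGraph (∑ i, C (r i) * X i + C c) A F ∩ torusLocus ℂ (s + 2)).Nonempty ∧
      IsRotund ℂ (s + 2) (polyFibredGraph (∑ i, C (r i) * X i + C c) A F ∩ torusLocus ℂ (s + 2)) ∧
      IsAddFree ℂ (s + 2) (polyFibredGraph (∑ i, C (r i) * X i + C c) A F ∩ torusLocus ℂ (s + 2)) ∧
      IsMulFree ℂ (s + 2) (polyFibredGraph (∑ i, C (r i) * X i + C c) A F ∩ torusLocus ℂ (s + 2)) ∧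
      zariskiDim ℂ (polyFibredGraph (∑ i, C (r i) * X i + C c) A F) = (s + 2 : ℕ) ∧
      addProjDim ℂ (s + 2) (polyFibredGraph (∑ i, C (r i) * X i + C c) A F) = (s + 1 : ℕ)) ∧
    ¬ IsLinearSplit ℂ (s + 2) (polyFibredGraph (∑ i, C (r i) * X i + C c) A F) ∧
    UnprojectedDense (polyFibredGraph (∑ i, C (r i) * X i + C c) A F) := by
  classical
  have hA0 : ∀ j, A j ≠ 0 := by
    intro j hj
    have h1 : (aeval A : MvPolynomial (Fin (s + 1)) ℂ →ₐ[ℂ] MvPolynomial (Fin (s + 1)) ℂ) (X j) =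
        (aeval A : MvPolynomial (Fin (s + 1)) ℂ →ₐ[ℂ] MvPolynomial (Fin (s + 1)) ℂ) 0 := by
      rw [aeval_X, hj, map_zero]
    exact X_ne_zero j (hA h1)
  -- some `Im rᵢ ≠ 0`, hence `rᵢ ∉ ℚ`
  obtain ⟨i, hi⟩ : ∃ i, (r i).im ≠ 0 := by
    by_contra hcon
    push Not at hcon
    have : ∑ i, (r i).im * (q₀ i : ℝ) = 0 := Finset.sum_eq_zero fun i _ => by rw [hcon i, zero_mul]
    linarith
  exact ⟨ecCell_hypotheses_polyFibredGraph_hyperplaneC r c A F hA ⟨i, forall_rat_ne_of_im_ne_zero hi⟩,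
    not_isLinearSplit_polyFibredGraph _ _ _ (Nat.succ_pos s) hA,
    unprojectedDense_polyFibredGraph_hyperplaneC r c q₀ hq₀0 hq₀ A hA0 F⟩

/-- **Example in `EC(3,2)`**: `{x₂ = i x₀ + x₁, y₀ = x₀ + y₂ x₁, y₁ = x₁ + y₂²}`
(`e^z = z + w e^{iz+w}`, `e^w = w + e^{2(iz+w)}`): certified member over a non-real plane, not linearly
split, Zariski dense exponential points (ray `q₀ = (1, 1)`: `Σ Im(rᵢ) q₀ᵢ = 1 > 0`). (new)
[cite: MantovaMasser2023, §1 p.5 (the open case dim π(V) = 2 in ℂ³×ℂˣ³)] -/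
theorem nonRealPlane_model_member_dense :
    (IsIrreducibleClosed ℂ (polyFibredGraph (∑ i, C ((![I, 1] : Fin 2 → ℂ) i) * X i + C 0)
        (fun j => X j) ![X 2, X 0]) ∧
      (polyFibredGraph (∑ i, C ((![I, 1] : Fin 2 → ℂ) i) * X i + C 0) (fun j => X j) ![X 2, X 0] ∩
        torusLocus ℂ 3).Nonempty ∧
      IsRotund ℂ 3 (polyFibredGraph (∑ i, C ((![I, 1] : Fin 2 → ℂ) i) * X i + C 0) (fun j => X j)
        ![X 2, X 0] ∩ torusLocus ℂ 3) ∧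
      IsAddFree ℂ 3 (polyFibredGraph (∑ i, C ((![I, 1] : Fin 2 → ℂ) i) * X i + C 0) (fun j => X j)
        ![X 2, X 0] ∩ torusLocus ℂ 3) ∧
      IsMulFree ℂ 3 (polyFibredGraph (∑ i, C ((![I, 1] : Fin 2 → ℂ) i) * X i + C 0) (fun j => X j)
        ![X 2, X 0] ∩ torusLocus ℂ 3) ∧
      zariskiDim ℂ (polyFibredGraph (∑ i, C ((![I, 1] : Fin 2 → ℂ) i) * X i + C 0) (fun j => X j)
        ![X 2, X 0]) = (3 : ℕ) ∧
      addProjDim ℂ 3 (polyFibredGraph (∑ i, C ((![I, 1] : Fin 2 → ℂ) i) * X i + C 0) (fun j => X j)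
        ![X 2, X 0]) = (2 : ℕ)) ∧
    ¬ IsLinearSplit ℂ 3 (polyFibredGraph (∑ i, C ((![I, 1] : Fin 2 → ℂ) i) * X i + C 0)
        (fun j => X j) ![X 2, X 0]) ∧
    UnprojectedDense (polyFibredGraph (∑ i, C ((![I, 1] : Fin 2 → ℂ) i) * X i + C 0) (fun j => X j)
        ![X 2, X 0]) := by
  have hA : Function.Injective (aeval (fun j : Fin 2 => (X j : MvPolynomial (Fin 2) ℂ)) :
      MvPolynomial (Fin 2) ℂ →ₐ[ℂ] MvPolynomial (Fin 2) ℂ) := by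
    rw [aeval_X_left]; exact fun _ _ h => h
  refine polyFibredGraph_hyperplaneC_member_dense _ 0 ![1, 1] (fun j => by fin_cases j <;> simp) ?_
    _ hA _
  rw [Fin.sum_univ_two]
  simp

end ComplexHyperplane

end Summit.Schanuel.Schanuel.Theorems

end
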